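import Summits.AtomisticToContinuum.FouriersLaw.Theorems.LocalOhmBVNoLocalIntegralsSmooth

/-!
# `NoLocalIntegrals` helper A2: sites an observable depends on

Helper file of the support item `NoLocalIntegrals` (stmt-AtomisticToContinuum-12074) of route `LocalOhmBV`
(sub-problem `FouriersLaw`): a small toolkit around Mathlib's `DependsOn f s` for observables of the
infinite chain — evaluation under updates off `s`, intersection of dependence sets, the sets read by
shifted / reflected / frozen / combined observables and by the coordinate partial derivatives, and the
vanishing of the partial derivatives off the set read.
-/

noncomputable section

open scoped ContDiff
open Set Function Literature.MathematicalPhysics.KineticTheory.HeatConduction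

namespace Summit.AtomisticToContinuum.FouriersLaw.Theorems.LocalOhmBV

variable {f g : ChainConfig → ℝ}

/-! ### Sites an observable depends on -/

/-- An observable not depending on the site `x` is unchanged by updates at `x`. -/
theorem dependsOn_apply_update {s : Set ℤ} (h : DependsOn f s) {x : ℤ} (hx : x ∉ s) (σ : ChainConfig)
    (v : ℝ × ℝ) : f (Function.update σ x v) = f σ :=
  h fun i hi => by rw [Function.update_of_ne (ne_of_mem_of_not_mem hi hx)]

/-- An observable depending only on `s` and only on `t` depends only on `s ∩ t`. -/
theorem dependsOn_inter {s t : Set ℤ} (hs : DependsOn f s) (ht : DependsOn f t) : DependsOn f (s ∩ t) := by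
  classical
  intro σ σ' h
  let θ : ChainConfig := fun i => if i ∈ s then σ i else σ' i
  have h1 : f σ = f θ := hs fun i hi => by simp [θ, hi]
  have h2 : f θ = f σ' := ht fun i hi => by
    by_cases his : i ∈ s
    · simp [θ, his, h i ⟨his, hi⟩]
    · simp [θ, his]
  exact h1.trans h2

/-- Sites read by a shifted observable. -/
theorem dependsOn_comp_shiftPow {s : Set ℤ} (h : DependsOn f s) (k : ℤ) :
    DependsOn (f ∘ shiftPow k) {y | y - k ∈ s} := by
  intro σ σ' hσ
  simp only [Function.comp_apply]
  refine h fun i hi => ?_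
  simp only [shiftPow_apply]
  exact hσ (i + k) (by simpa using hi)

/-- Sites read by a reflected observable. -/
theorem dependsOn_comp_reflectZ {s : Set ℤ} (h : DependsOn f s) :
    DependsOn (f ∘ reflectZ) {y | -y ∈ s} := by
  intro σ σ' hσ
  simp only [Function.comp_apply]
  refine h fun i hi => ?_
  simp only [reflectZ_apply]
  exact hσ (-i) (by simpa using hi)

/-- Freezing a site removes it from the set of sites read. -/
theorem dependsOn_comp_update {s : Set ℤ} (h : DependsOn f s) (x : ℤ) (v : ℝ × ℝ) :
    DependsOn (fun σ => f (Function.update σ x v)) (s \ {x}) := by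
  intro σ σ' hσ
  refine h fun i hi => ?_
  by_cases hix : i = x
  · subst hix; simp
  · rw [Function.update_of_ne hix, Function.update_of_ne hix]
    exact hσ i ⟨hi, hix⟩

/-- A binary combination reads at most the sites read by its arguments. -/
theorem dependsOn_map₂ {s : Set ℤ} (φ : ℝ → ℝ → ℝ) (hf : DependsOn f s) (hg : DependsOn g s) :
    DependsOn (fun σ => φ (f σ) (g σ)) s :=
  fun _ _ h => congr_arg₂ φ (hf h) (hg h)

/-- A unary image reads at most the sites read by its argument. -/
theorem dependsOn_map {s : Set ℤ} (φ : ℝ → ℝ) (hf : DependsOn f s) : DependsOn (fun σ => φ (f σ)) s :=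
  fun _ _ h => congr_arg φ (hf h)

/-- The coordinate `q_x` reads only the site `x`. -/
theorem dependsOn_fst (x : ℤ) : DependsOn (fun σ : ChainConfig => (σ x).1) {x} :=
  fun _ _ h => congr_arg Prod.fst (h x rfl)

/-- The coordinate `p_x` reads only the site `x`. -/
theorem dependsOn_snd (x : ℤ) : DependsOn (fun σ : ChainConfig => (σ x).2) {x} :=
  fun _ _ h => congr_arg Prod.snd (h x rfl)

/-- A position partial derivative reads at most the sites read by the observable. -/
theorem dependsOn_partialQZ {s : Set ℤ} (h : DependsOn f s) (x : ℤ) : DependsOn (partialQZ x f) s := by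
  classical
  intro σ σ' hσ
  unfold partialQZ
  by_cases hx : x ∈ s
  · have hq : (σ x) = (σ' x) := hσ x hx
    rw [hq]
    congr 1
    funext t
    refine h fun i hi => ?_
    by_cases hix : i = x
    · subst hix; simp
    · rw [Function.update_of_ne hix, Function.update_of_ne hix]; exact hσ i hi
  · have h1 : (fun t => f (Function.update σ x (t, (σ x).2))) = fun _ => f σ :=
      funext fun t => dependsOn_apply_update h hx σ _
    have h2 : (fun t => f (Function.update σ' x (t, (σ' x).2))) = fun _ => f σ' :=
      funext fun t => dependsOn_apply_update h hx σ' _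
    rw [h1, h2, deriv_const, deriv_const]

/-- A momentum partial derivative reads at most the sites read by the observable. -/
theorem dependsOn_partialPZ {s : Set ℤ} (h : DependsOn f s) (x : ℤ) : DependsOn (partialPZ x f) s := by
  classical
  intro σ σ' hσ
  unfold partialPZ
  by_cases hx : x ∈ s
  · have hq : (σ x) = (σ' x) := hσ x hx
    rw [hq]
    congr 1
    funext t
    refine h fun i hi => ?_
    by_cases hix : i = x
    · subst hix; simp
    · rw [Function.update_of_ne hix, Function.update_of_ne hix]; exact hσ i hi
  · have h1 : (fun t => f (Function.update σ x ((σ x).1, t))) = fun _ => f σ :=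
      funext fun t => dependsOn_apply_update h hx σ _
    have h2 : (fun t => f (Function.update σ' x ((σ' x).1, t))) = fun _ => f σ' :=
      funext fun t => dependsOn_apply_update h hx σ' _
    rw [h1, h2, deriv_const, deriv_const]

/-- Outside the sites it reads, an observable has vanishing position partial derivative. -/
theorem partialQZ_eq_zero_of_dependsOn {s : Set ℤ} (h : DependsOn f s) {x : ℤ} (hx : x ∉ s) :
    partialQZ x f = 0 := by
  funext σ
  unfold partialQZ
  have h1 : (fun t => f (Function.update σ x (t, (σ x).2))) = fun _ => f σ :=
    funext fun t => dependsOn_apply_update h hx σ _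
  rw [h1, deriv_const]
  rfl

/-- Outside the sites it reads, an observable has vanishing momentum partial derivative. -/
theorem partialPZ_eq_zero_of_dependsOn {s : Set ℤ} (h : DependsOn f s) {x : ℤ} (hx : x ∉ s) :
    partialPZ x f = 0 := by
  funext σ
  unfold partialPZ
  have h1 : (fun t => f (Function.update σ x ((σ x).1, t))) = fun _ => f σ :=
    funext fun t => dependsOn_apply_update h hx σ _
  rw [h1, deriv_const]
  rfl

end Summit.AtomisticToContinuum.FouriersLaw.Theorems.LocalOhmBV
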